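import Summits.BirchSwinnertonDyer.BirchSwinnertonDyer.Theorems.TeichmullerTwistDescentKOfBorelEigenfunctional
import Summits.BirchSwinnertonDyer.BirchSwinnertonDyer.Theorems.TeichmullerTwistDescentMackeyDefs
import HarnessLib

/-!
# Route `TeichmullerTwistDescent`, crux K `TwistedPeriodLatticeSaturation` (stmt-BirchSwinnertonDyer-25368):
# (I1⁗) ⟹ (I1‴), and K from modularity, the twisted Borel period sum (I1⁗) and the weight exclusion (W‴)

Cell `pub/bsd-wall` (D-0145 line route-BirchSwinnertonDyer-TeichmullerTwistDescent, OPEN rev 7), seat `bsd-line-ttd-p1`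
(prover 1/2, g25).  THEOREMS ONLY; `--supports stmt-BirchSwinnertonDyer-25368`.  BSD is not proved; K is NOT proved (conditional);
nothing here closes an item.

* **`nonzeroBorelEigenfunctional_of_twistedBorelPeriodSum : TwistedBorelPeriodSumNonvanishing → NonzeroBorelEigenfunctional`**
  — `λ := μ ∘ mackeyFunctional(v(s₀)) ∘ spreadPeriod f_D` is a Borel eigenfunctional (`mackeyFunctional_translate`,
  `spreadElt_H1carrierRep`), kills `ker(spreadPeriod f_D)`, and is nonzero at the witness.
* **`twistedPeriodLatticeSaturation_of_mackey_of_noEtaleWeightEigenQuotient (hnf) (hM) (hW) : K`** (route decl verbatim).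
STATE OF THE K-LINE: K ⟸ `exists_isNewformOf` ∧ (I1⁗) ∧ (W‴): (I1⁗) = a single explicit `ℤ_p ⊗ Λ_{f}`-valued twisted sum of
torus-averaged period classes of `f_W` is nonzero (⟺ the tame principal series occurs in the `f_W`-part of the full-level
homology ⟺ `f_W ⊗ ω̃^{∓b}` has level `pM`); (W‴) = the Serre-weight exclusion on the carrier.
[cite: SerreLinearRepresentations1977, §7.3] [cite: AshStevens1986, §1 (1.2)–(1.4)]
-/

set_option autoImplicit false
-- single-conjunct summit: `Summit.BirchSwinnertonDyer.BirchSwinnertonDyer.…` repeats the name by design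
set_option linter.dupNamespace false

noncomputable section

open scoped Pointwise MatrixGroups TensorProduct

open Function CongruenceSubgroup
open Literature.RepresentationTheory.FiniteGroups Literature.RepresentationTheory.FiniteGroups.GL2
  Literature.NumberTheory.EllipticCurves.ModularForms
open Literature.NumberTheory.EllipticCurves (Kato2004.teichmullerChar)
open Literature.NumberTheory.ModularSymbols Literature.NumberTheory.ModularSymbols.FullLevel
open Literature.Algebra.Homology

namespace Summit.BirchSwinnertonDyer.BirchSwinnertonDyer.Theorems.TeichmullerTwistDescent

open WeierstrassCurve Literature.NumberTheory.EllipticCurves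

namespace KOfMackeyFunctional

/-- **(I1⁗) ⟹ (I1‴)**: the functional `λ := μ ∘ (Mackey sum at v(s₀)) ∘ spreadPeriod f_D` on the carrier is `ℤ_p`-linear,
a `(B, ω̃^{p−1−b} ⊗ ω̃ᵇ)`-eigenfunctional (`mackeyFunctional_translate` + equivariance of the spread), vanishes on
`ker(spreadPeriod f_D)` trivially, and is nonzero by (I1⁗).  BSD is not proved by this.
[cite: SerreLinearRepresentations1977, §7.3] [cite: AshStevens1986, §1 (1.2)–(1.3)] -/
theorem nonzeroBorelEigenfunctional_of_twistedBorelPeriodSum (h : TwistedBorelPeriodSumNonvanishing) :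
    NonzeroBorelEigenfunctional := by
  intro p M _ _ _ hpM _ _ W _ _ hN D hp11 hadd hirr hGo hV4
  obtain ⟨hb, hb2, s₀, z₀, μ, hμ⟩ := h p M hpM W hN D hp11 hadd hirr hGo hV4
  set b := tameExponent p W with hbdef
  let mk : H1carrier ℤ_[p] p M →ₗ[ℤ_[p]] ℤ_[p] ⊗[ℤ] ↥(periodLattice D.f).toIntSubmodule :=
    (mackeyFunctional (Kato2004.teichmullerChar p ^ (p - 1 - b)) (Kato2004.teichmullerChar p ^ b) s₀).comp
      (spreadPeriod ℤ_[p] p M hpM D.f)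
  refine ⟨hb, hb2, μ.comp mk, ?_, ?_, ?_⟩
  · intro h0
    apply hμ
    have := LinearMap.congr_fun h0 z₀
    rw [LinearMap.zero_apply, LinearMap.comp_apply, LinearMap.comp_apply] at this
    exact this
  · intro β z
    have hsp : spreadPeriod ℤ_[p] p M hpM D.f (H1carrierRep ℤ_[p] p M (β : GL (Fin 2) (ZMod p)) z) =
        fun x => spreadPeriod ℤ_[p] p M hpM D.f z (x * (β : GL (Fin 2) (ZMod p))) := by
      have h := congrArg Subtype.val (spreadElt_H1carrierRep ℤ_[p] p M hpM D.f (β : GL (Fin 2) (ZMod p)) z)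
      simp only [coe_spreadElt] at h
      exact h
    change μ (mackeyFunctional _ _ s₀ (spreadPeriod ℤ_[p] p M hpM D.f (H1carrierRep ℤ_[p] p M _ z))) =
      _ * μ (mackeyFunctional _ _ s₀ (spreadPeriod ℤ_[p] p M hpM D.f z))
    rw [hsp, mackeyFunctional_translate, map_smul, smul_eq_mul]
  · intro z hz
    change μ (mackeyFunctional _ _ s₀ (spreadPeriod ℤ_[p] p M hpM D.f z)) = 0
    rw [hz, map_zero, map_zero]

/-- **K from modularity, the twisted Borel period sum (I1⁗) and the Ash–Stevens weight exclusion (W‴).**  Conclusion = the route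
decl `TwistedPeriodLatticeSaturation` VERBATIM; BSD is not proved by this; K is proved CONDITIONALLY on the three named
hypotheses. [cite: EdixhovenManin1991, §4] [cite: SerreLinearRepresentations1977, §7.3] -/
theorem twistedPeriodLatticeSaturation_of_mackey_of_noEtaleWeightEigenQuotient (hnf : exists_isNewformOf)
    (hM : TwistedBorelPeriodSumNonvanishing) (hW : NoEtaleWeightEigenQuotient) :
    Summit.BirchSwinnertonDyer.BirchSwinnertonDyer.Theses.TeichmullerTwistDescent.TwistedPeriodLatticeSaturation :=
  KOfBorelEigenfunctional.twistedPeriodLatticeSaturation_of_borel_of_noEtaleWeightEigenQuotient hnf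
    (nonzeroBorelEigenfunctional_of_twistedBorelPeriodSum hM) hW

end KOfMackeyFunctional

end Summit.BirchSwinnertonDyer.BirchSwinnertonDyer.Theorems.TeichmullerTwistDescent
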